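import Summits.CriticalPhenomena.PercolationContinuityZ3.Theorems.PercNearOneGluingNoHeavyLowerTailQuantitativeBHKRepulsion
import Summits.CriticalPhenomena.PercolationContinuityZ3.Theorems.PercNearOneGluingNoHeavyLowerTailQuantitativeBHKSeparation
import Literature.Probability.LatticeModels.ProdBernoulliAtomExpansion
import HarnessLib

/-!
# The blocking floor at one level (quantitative BHK Thm 1.3 with the roles swapped; «(blk)» member of BENCH row M2-R11, level form)

Support file (`--supports stmt-CriticalPhenomena-4575`), prover seat `prim-rate-mine-2` (lane prim-rate, constants-miner (c), BENCH row
M2-R11 (blk); `run/shared/lean/prim/prim-rate/prim-rate-mine-2/CANDIDATES.md` §gen-2, PROOFS.md §P8–P10).  No definitions, no named facts,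
no sorries; standard axioms.  Setting: weights supported on a pair set `E`, `D = {s ↮ t}`, `C_s = openCluster ω s`, a vertex `a`, a level
`r : ℝ`, and the BLOCKING POTENTIAL `φ(ω) = −P_{C_s}(t↔o)` (minus the probability that `t ↔ o` in a fresh configuration off the pairs meeting
`C_s`; increasing in `C_s`).  A vertex set `U` is ATTACHED to `C_s` if every vertex of `U` is joined to `s` by pairs of `E` avoiding `t` with both
endpoints in `C_s ∪ U` (so `C_s ∪ U` is again a cluster shape), and `φ_U(ω) = −P_{C_s ∪ U}(t↔o)`.  The level-`r` HULL EVENT is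
`H_r = {φ ≤ r, a ∉ C_s, and every attached U with φ_U > r contains a}` («blocking t ↔ o beyond level r FORCES absorbing a»).  Then

  `μ(D ∩ {φ > r}) · μ(D ∩ H_r) ≤ μ(D)·μ(D ∩ {φ > r} ∩ {s↔a}) − μ(D ∩ {φ > r})·μ(D ∩ {s↔a})`,

i.e. `Cov(1{φ > r}, 1{s↔a} | s↮t) ≥ ν(φ > r)·ν(H_r)` — `QuantBHK.condCov_level_openConn_ge_blocking`.  This is the abstract majorant floor
`QuantBHK.condCov_ge_majorant_gap` (BHK Thm 1.3) for the increasing event `B′ = {φ > r}` against `g′ = 1{a ∈ C_s}` with the monotone hull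
`g̃′ = 1{a ∈ C_s} ∨ 1_{H_r}` (ROLES SWAPPED relative to the attachment floor; mine-ref-g7's typing, BENCH M2-R11), made increasing on ALL edge
sets by the lifted cluster `R(W) = openCluster (W ∩ E_t) s`, `E_t` = pairs of `E` avoiding `t`.  Integrating over `r` (layer cake) gives the
(blk) floor for `−Cov(1{s↔a}, 1{t↔o} | s↮t)`; that assembly is a separate file.
[cite: VandenbergHaggstromKahn2005, Thm. 1.3 (p. 6), Thm. 1.4 and eq. (2) (pp. 2, 7)]
-/

noncomputable section

namespace Summit.CriticalPhenomena.PercolationContinuityZ3.Theorems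

open MeasureTheory Set Literature.Probability.LatticeModels Literature.Probability.Percolation
open scoped Classical
open Literature.Probability.Percolation.BHK2006 DecisionTree

namespace QuantBHK

universe v

variable {V : Type v} [Fintype V]

omit [Fintype V] in
/-- On `{s ↮ t}` no pair of the open edge cluster of `s` contains `t`. [folklore] -/
theorem openEdgeCluster_inter_avoid_eq {ω : BondConfig V} {s t : V} {E : Set (Sym2 V)} (hωE : ω ⊆ E)
    (hst : ¬ (openGraph ω).Reachable s t) :
    openEdgeCluster ω s ∩ {e | e ∈ E ∧ t ∉ e} = openEdgeCluster ω s := by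
  refine Set.inter_eq_left.2 fun e he => ⟨hωE (openEdgeCluster_subset ω s he), fun hte => hst ?_⟩
  exact he.2.2 t hte

/-- **Blocking floor at level `r` (quantitative BHK Thm 1.3, roles swapped).**  Weights supported on the pair set `E` (`w e = 0` off `E`),
`D = {s ↮ t}`, `s ≠ t`, vertices `a, o`, a level `r`, `C_s = openCluster ω s`, `φ(ω) = −μ{η : t ↔ o in η off the pairs meeting C_s}`,
`φ_U(ω)` the same with `C_s ∪ U` deleted, `U` ATTACHED to `C_s` when every `u ∈ U` is joined to `s` by pairs of `E` avoiding `t` with endpoints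
in `C_s ∪ U`, and `H_r = {φ ≤ r ∧ a ∉ C_s ∧ ∀ attached U, φ_U > r → a ∈ C_s ∪ U}`.  Then
  `μ(D ∩ {r < φ})·μ(D ∩ H_r) ≤ μ(D)·μ(D ∩ {r < φ} ∩ {s↔a}) − μ(D ∩ {r < φ})·μ(D ∩ {s↔a})`,
i.e. `Cov(1{φ > r}, 1{s ↔ a} | s ↮ t) ≥ ν(φ > r)·ν(H_r)`: the level form of the (blk) member of BENCH row M2-R11 (prim-rate lane).  Proof:
`condCov_ge_majorant_gap` at `X = {t}` with `F = 1{r < φ(R W)}`, `G = 1{a ∈ R W}`, `G̃ = G ∨ 1{φ(R W) ≤ r ∧ Hull}`, `R(W) = openCluster (W ∩ E_t) s`.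
[cite: VandenbergHaggstromKahn2005, Thm. 1.3 (p. 6)] -/
theorem condCov_level_openConn_ge_blocking (w : Sym2 V → unitInterval) (E : Set (Sym2 V))
    (hE : ∀ e, e ∉ E → (w e : ℝ) = 0) (s t a o : V) (hst : s ≠ t) (r : ℝ) :
    (prodBernoulli w).real ({ω : BondConfig V | ¬ (openGraph ω).Reachable s t} ∩
        {ω | r < -(prodBernoulli w).real {η : BondConfig V |
          (openGraph (η \ {e | ∃ v ∈ e, v ∈ openCluster ω s})).Reachable t o}}) *
      (prodBernoulli w).real ({ω : BondConfig V | ¬ (openGraph ω).Reachable s t} ∩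
        {ω | -(prodBernoulli w).real {η : BondConfig V |
              (openGraph (η \ {e | ∃ v ∈ e, v ∈ openCluster ω s})).Reachable t o} ≤ r ∧
            a ∉ openCluster ω s ∧
            ∀ U : Set V, (∀ u ∈ U, (openGraph {e | (e ∈ E ∧ t ∉ e) ∧
                ∀ v ∈ e, v ∈ openCluster ω s ∨ v ∈ U}).Reachable s u) →
              r < -(prodBernoulli w).real {η : BondConfig V |
                (openGraph (η \ {e | ∃ v ∈ e, v ∈ openCluster ω s ∨ v ∈ U})).Reachable t o} →
              a ∈ openCluster ω s ∨ a ∈ U}) ≤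
    (prodBernoulli w).real {ω : BondConfig V | ¬ (openGraph ω).Reachable s t} *
        (prodBernoulli w).real ({ω : BondConfig V | ¬ (openGraph ω).Reachable s t} ∩
          {ω | r < -(prodBernoulli w).real {η : BondConfig V |
            (openGraph (η \ {e | ∃ v ∈ e, v ∈ openCluster ω s})).Reachable t o}} ∩ openConn s a) -
      (prodBernoulli w).real ({ω : BondConfig V | ¬ (openGraph ω).Reachable s t} ∩
          {ω | r < -(prodBernoulli w).real {η : BondConfig V |
            (openGraph (η \ {e | ∃ v ∈ e, v ∈ openCluster ω s})).Reachable t o}}) *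
        (prodBernoulli w).real ({ω : BondConfig V | ¬ (openGraph ω).Reachable s t} ∩ openConn s a) := by
  set μ := prodBernoulli w with hμ
  set D : Set (BondConfig V) := {ω : BondConfig V | ¬ (openGraph ω).Reachable s t} with hD
  have hDX : {ω : BondConfig V | ∀ x ∈ ({t} : Set V), ¬ (openGraph ω).Reachable s x} = D := by
    ext ω; simp [hD]
  have hmeas : ∀ S : Set (BondConfig V), MeasurableSet S := fun _ => MeasurableSet.of_discrete
  have hsnt : s ∉ ({t} : Set V) := by simpa using hst
  -- the support pairs avoiding `t`, the lifted cluster, the potential, attachment and the hull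
  set Et : Set (Sym2 V) := {e | e ∈ E ∧ t ∉ e} with hEt
  set R : Set (Sym2 V) → Set V := fun W => openCluster (W ∩ Et) s with hR
  set P : Set V → ℝ := fun C => μ.real {η : BondConfig V |
    (openGraph (η \ {e | ∃ v ∈ e, v ∈ C})).Reachable t o} with hP
  set Pu : Set V → Set V → ℝ := fun C U => μ.real {η : BondConfig V |
    (openGraph (η \ {e | ∃ v ∈ e, v ∈ C ∨ v ∈ U})).Reachable t o} with hPu
  set att : Set V → Set V → Prop := fun C U =>
    ∀ u ∈ U, (openGraph {e | (e ∈ E ∧ t ∉ e) ∧ ∀ v ∈ e, v ∈ C ∨ v ∈ U}).Reachable s u with hatt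
  set hull : Set V → Prop := fun C => ∀ U : Set V, att C U → r < -Pu C U → a ∈ C ∨ a ∈ U with hhull
  have hPanti : ∀ C C' : Set V, C ⊆ C' → P C' ≤ P C := by
    intro C C' h
    have hsub : ({e | ∃ v ∈ e, v ∈ C} : Set (Sym2 V)) ⊆ {e | ∃ v ∈ e, v ∈ C'} :=
      fun e ⟨v, hv, hvC⟩ => ⟨v, hv, h hvC⟩
    exact measureReal_mono fun η hη => (show (openGraph (η \ {e | ∃ v ∈ e, v ∈ C'})).Reachable t o from hη).mono
      (openGraph_le (sdiff_le_sdiff_left hsub))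
  have hPu_le : ∀ C C' U U' : Set V, C ∪ U ⊆ C' ∪ U' → Pu C' U' ≤ Pu C U := by
    intro C C' U U' h
    have hsub : ({e | ∃ v ∈ e, v ∈ C ∨ v ∈ U} : Set (Sym2 V)) ⊆ {e | ∃ v ∈ e, v ∈ C' ∨ v ∈ U'} :=
      fun e ⟨v, hv, hvC⟩ => ⟨v, hv, h hvC⟩
    exact measureReal_mono fun η hη => (show (openGraph (η \ {e | ∃ v ∈ e, v ∈ C' ∨ v ∈ U'})).Reachable t o from hη).mono
      (openGraph_le (sdiff_le_sdiff_left hsub))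
  have hPu_self : ∀ C : Set V, Pu C C = P C := by
    intro C
    simp only [hPu, hP, or_self]
  have hRmono : ∀ W W' : Set (Sym2 V), W ⊆ W' → R W ⊆ R W' := fun W W' h =>
    openCluster_mono (Set.inter_subset_inter_left Et h) s
  -- attachment transfer
  have hatt_R : ∀ (W : Set (Sym2 V)) (C : Set V), att C (R W) := by
    intro W C u hu
    obtain ⟨p⟩ := (hu : (openGraph (W ∩ Et)).Reachable s u)
    refine ⟨p.transfer (openGraph {e | (e ∈ E ∧ t ∉ e) ∧ ∀ v ∈ e, v ∈ C ∨ v ∈ R W}) fun e he => ?_⟩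
    have he' := p.edges_subset_edgeSet he
    rw [openGraph, SimpleGraph.edgeSet_fromEdgeSet] at he'
    rw [openGraph, SimpleGraph.edgeSet_fromEdgeSet]
    refine ⟨⟨he'.1.2, fun v hv => Or.inr ?_⟩, he'.2⟩
    exact (p.takeUntil v (SimpleGraph.Walk.mem_support_of_mem_edges he hv)).reachable
  have hatt_union : ∀ (W : Set (Sym2 V)) (C U : Set V), C ⊆ R W → att (R W) U → att C (U ∪ R W) := by
    intro W C U hC hU u hu
    rcases hu with hu | hu
    · refine (hU u hu).mono (openGraph_le fun e he => ⟨he.1, fun v hv => ?_⟩)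
      rcases he.2 v hv with h1 | h1
      · exact Or.inr (Or.inr h1)
      · exact Or.inr (Or.inl h1)
    · refine (hatt_R W C u hu).mono (openGraph_le fun e he => ⟨he.1, fun v hv => ?_⟩)
      rcases he.2 v hv with h1 | h1
      · exact Or.inl h1
      · exact Or.inr (Or.inr h1)
  -- the hull is increasing along the lifted cluster
  have hhull_up : ∀ W W' : Set (Sym2 V), W ⊆ W' → hull (R W) → -P (R W') ≤ r → hull (R W') := by
    intro W W' hWW' hW _ U hU hrU
    have h1 := hW (U ∪ R W') (hatt_union W' (R W) U (hRmono W W' hWW') hU)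
    have h2 : Pu (R W) (U ∪ R W') ≤ Pu (R W') U := by
      refine hPu_le _ _ _ _ fun v hv => ?_
      rcases hv with hv | hv
      · exact Or.inr (Or.inr hv)
      · exact Or.inr (Or.inl hv)
    rcases h1 (lt_of_lt_of_le hrU (neg_le_neg h2)) with h3 | h3 | h3
    · exact Or.inl (hRmono W W' hWW' h3)
    · exact Or.inr h3
    · exact Or.inl h3
  have hhull_force : ∀ W W' : Set (Sym2 V), W ⊆ W' → hull (R W) → r < -P (R W') → a ∈ R W' := by
    intro W W' hWW' hW hr
    have h1 := hW (R W') (hatt_R W' (R W))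
    have h2 : Pu (R W) (R W') ≤ P (R W') := by
      rw [← hPu_self]
      refine hPu_le _ _ _ _ fun v hv => ?_
      rcases hv with hv | hv <;> exact Or.inr hv
    rcases h1 (lt_of_lt_of_le hr (neg_le_neg h2)) with h3 | h3
    · exact hRmono W W' hWW' h3
    · exact h3
  have hhull_of_mem : ∀ C : Set V, a ∈ C → hull C := fun C ha U _ _ => Or.inl ha
  -- the three functionals
  set F : Set (Sym2 V) → ℝ := fun W => if r < -P (R W) then 1 else 0 with hF
  set G : Set (Sym2 V) → ℝ := fun W => if a ∈ R W then 1 else 0 with hG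
  set Gt : Set (Sym2 V) → ℝ := fun W => if (a ∈ R W ∨ (-P (R W) ≤ r ∧ hull (R W))) then 1 else 0 with hGt
  have hFmono : Monotone F := by
    intro W W' h
    simp only [hF]
    by_cases h1 : r < -P (R W)
    · rw [if_pos h1, if_pos (lt_of_lt_of_le h1 (neg_le_neg (hPanti _ _ (hRmono W W' h))))]
    · rw [if_neg h1]; split_ifs <;> norm_num
  have hGtmono : Monotone Gt := by
    intro W W' h
    simp only [hGt]
    by_cases h1 : (a ∈ R W ∨ (-P (R W) ≤ r ∧ hull (R W)))
    · rw [if_pos h1]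
      have h2 : (a ∈ R W' ∨ (-P (R W') ≤ r ∧ hull (R W'))) := by
        rcases h1 with h1 | ⟨h1, h1'⟩
        · exact Or.inl (hRmono W W' h h1)
        · by_cases h3 : r < -P (R W')
          · exact Or.inl (hhull_force W W' h h1' h3)
          · exact Or.inr ⟨not_lt.1 h3, hhull_up W W' h h1' (not_lt.1 h3)⟩
      rw [if_pos h2]
    · rw [if_neg h1]; split_ifs <;> norm_num
  have hFG : ∀ W, F W * Gt W = F W * G W := by
    intro W
    simp only [hF, hG, hGt]
    by_cases h1 : r < -P (R W)
    · rw [if_pos h1]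
      by_cases h2 : a ∈ R W
      · rw [if_pos (Or.inl h2), if_pos h2]
      · rw [if_neg h2, if_neg (fun h => h.elim h2 fun h' => (not_lt.2 h'.1) h1)]
    · rw [if_neg h1, zero_mul, zero_mul]
  have key := condCov_ge_majorant_gap w s ({t} : Set V) hsnt F G Gt hFmono hGtmono hFG
  rw [hDX, ← hμ] at key
  -- a.s. on `D`: pairs off `E` are closed and the cluster avoids `t`, so `R (C_s^edge) = C_s`
  have hnull : μ {ω : BondConfig V | ∃ e ∈ (Eᶜ : Set (Sym2 V)).toFinset, e ∈ ω} = 0 :=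
    prodBernoulli_setOf_exists_mem_eq_zero w _ fun e he => hE e (by simpa using he)
  have hae : ∀ᵐ ω ∂μ, ω ∈ D → R (openEdgeCluster ω s) = openCluster ω s := by
    have h1 : ∀ᵐ ω ∂μ, ω ∉ {ω : BondConfig V | ∃ e ∈ (Eᶜ : Set (Sym2 V)).toFinset, e ∈ ω} :=
      measure_eq_zero_iff_ae_notMem.1 hnull
    filter_upwards [h1] with ω hω hωD
    have hωE : ω ⊆ E := by
      intro e he
      by_contra heE
      exact hω ⟨e, by simpa using heE, he⟩
    simp only [hR, hEt, openEdgeCluster_inter_avoid_eq hωE hωD, openCluster_openEdgeCluster]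
  have hint : ∀ (f : BondConfig V → ℝ) (A : Set (BondConfig V)),
      (∀ ω, R (openEdgeCluster ω s) = openCluster ω s → f ω = if ω ∈ A then (1 : ℝ) else 0) →
      ∫ ω in D, f ω ∂μ = μ.real (D ∩ A) := by
    intro f A hA
    have h1 : ∫ ω in D, f ω ∂μ = ∫ ω in D, A.indicator (fun _ => (1 : ℝ)) ω ∂μ := by
      refine setIntegral_congr_ae (hmeas D) ?_
      filter_upwards [hae] with ω hω hωD
      rw [hA ω (hω hωD), Set.indicator_apply]
    rw [h1, integral_indicator (hmeas A), Measure.restrict_restrict (hmeas A), integral_const, smul_eq_mul, mul_one,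
      Set.inter_comm, measureReal_restrict_apply_univ]
  -- the level event, the connection event, their intersection, and the hull event
  set Lev : Set (BondConfig V) := {ω | r < -P (openCluster ω s)} with hLev
  set Hev : Set (BondConfig V) := {ω | -P (openCluster ω s) ≤ r ∧ a ∉ openCluster ω s ∧ hull (openCluster ω s)} with hHev
  have hIF : ∫ ω in D, F (openEdgeCluster ω s) ∂μ = μ.real (D ∩ Lev) :=
    hint (fun ω => F (openEdgeCluster ω s)) Lev fun ω hω => by
      simp only [hF, hω]
      exact if_congr Iff.rfl rfl rfl
  have hIG : ∫ ω in D, G (openEdgeCluster ω s) ∂μ = μ.real (D ∩ openConn s a) :=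
    hint (fun ω => G (openEdgeCluster ω s)) (openConn s a) fun ω hω => by
      simp only [hG, hω]
      exact if_congr Iff.rfl rfl rfl
  have hIFG : ∫ ω in D, F (openEdgeCluster ω s) * G (openEdgeCluster ω s) ∂μ = μ.real (D ∩ Lev ∩ openConn s a) := by
    rw [Set.inter_assoc]
    refine hint (fun ω => F (openEdgeCluster ω s) * G (openEdgeCluster ω s)) (Lev ∩ openConn s a) fun ω hω => ?_
    simp only [hF, hG, hω]
    by_cases h1 : r < -P (openCluster ω s)
    · by_cases h2 : a ∈ openCluster ω s
      · rw [if_pos h1, if_pos h2, one_mul, if_pos (show ω ∈ Lev ∩ openConn s a from ⟨h1, h2⟩)]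
      · rw [if_pos h1, if_neg h2, one_mul, if_neg (show ω ∉ Lev ∩ openConn s a from fun h => h2 h.2)]
    · rw [if_neg h1, zero_mul, if_neg (show ω ∉ Lev ∩ openConn s a from fun h => h1 h.1)]
  have hIGt : ∫ ω in D, Gt (openEdgeCluster ω s) ∂μ = μ.real (D ∩ openConn s a) + μ.real (D ∩ Hev) := by
    have h1 := hint (fun ω => Gt (openEdgeCluster ω s))
      {ω | a ∈ openCluster ω s ∨ (-P (openCluster ω s) ≤ r ∧ hull (openCluster ω s))} fun ω hω => by
        simp only [hGt, hω]
        by_cases h : (a ∈ openCluster ω s ∨ (-P (openCluster ω s) ≤ r ∧ hull (openCluster ω s)))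
        · rw [if_pos h, if_pos (show ω ∈ {ω | a ∈ openCluster ω s ∨
            (-P (openCluster ω s) ≤ r ∧ hull (openCluster ω s))} from h)]
        · rw [if_neg h, if_neg (show ω ∉ {ω | a ∈ openCluster ω s ∨
            (-P (openCluster ω s) ≤ r ∧ hull (openCluster ω s))} from h)]
    have h2 : D ∩ {ω | a ∈ openCluster ω s ∨ (-P (openCluster ω s) ≤ r ∧ hull (openCluster ω s))} =
        (D ∩ openConn s a) ∪ (D ∩ Hev) := by
      ext ω
      simp only [Set.mem_inter_iff, Set.mem_setOf_eq, Set.mem_union, openConn, hHev]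
      constructor
      · rintro ⟨hω, h | ⟨h, h'⟩⟩
        · exact Or.inl ⟨hω, h⟩
        · by_cases ha : a ∈ openCluster ω s
          · exact Or.inl ⟨hω, ha⟩
          · exact Or.inr ⟨hω, h, ha, h'⟩
      · rintro (⟨hω, h⟩ | ⟨hω, h, _, h'⟩)
        · exact ⟨hω, Or.inl h⟩
        · exact ⟨hω, Or.inr ⟨h, h'⟩⟩
    have hdisj : Disjoint (D ∩ openConn s a) (D ∩ Hev) := by
      rw [Set.disjoint_left]
      rintro ω ⟨_, ha⟩ ⟨_, _, ha', _⟩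
      exact ha' ha
    rw [h1, h2, measureReal_union hdisj (hmeas _)]
  rw [hIF, hIG, hIFG, hIGt] at key
  have hLevD : D ∩ Lev = D ∩ {ω | r < -(μ.real {η : BondConfig V |
      (openGraph (η \ {e | ∃ v ∈ e, v ∈ openCluster ω s})).Reachable t o})} := rfl
  have hHevD : D ∩ Hev = D ∩ {ω | -(μ.real {η : BondConfig V |
        (openGraph (η \ {e | ∃ v ∈ e, v ∈ openCluster ω s})).Reachable t o}) ≤ r ∧ a ∉ openCluster ω s ∧
      ∀ U : Set V, (∀ u ∈ U, (openGraph {e | (e ∈ E ∧ t ∉ e) ∧ ∀ v ∈ e, v ∈ openCluster ω s ∨ v ∈ U}).Reachable s u) →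
        r < -(μ.real {η : BondConfig V | (openGraph (η \ {e | ∃ v ∈ e, v ∈ openCluster ω s ∨ v ∈ U})).Reachable t o}) →
        a ∈ openCluster ω s ∨ a ∈ U} := rfl
  rw [hLevD, hHevD] at key
  linarith [key]

end QuantBHK

end Summit.CriticalPhenomena.PercolationContinuityZ3.Theorems
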